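import Mathlib

/-!
# SoloInformedAdjoinRootSqueeze — the algebraic core of "(R) ⇒ (I)"
(solo-Langlands-informed s40, FINDING_I §2, step (6) of the GMA annihilator lemma)

If an `A`-algebra `R` is generated by a single element `x` which is a root of a polynomial `f`,
then every `A`-algebra map `R → A[X]/(f)` sending `x` to the class of `X` is bijective
(`adjoinRoot_squeeze_of_aeval`).  The case used in the cell model is `f = X (X - a)`
(`adjoinRoot_squeeze`): with `A = ℤ_7`, `a = 7^e u`, the flat pseudodeformation ring `R_Q` is
generated over `ℤ_7` by the generator `x` of its (principal) reducibility ideal, the annihilator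
argument gives `x (x - 7^e u) = 0`, and `R_Q` surjects onto the Eisenstein congruence algebra
`𝕋_Q = ℤ_7[X]/(X (X - 7^e))`; the lemma then forces `R_Q = 𝕋_Q`.
-/

namespace Summit.Langlands.Langlands.Theorems

open Polynomial

/-- **AdjoinRoot squeeze (general form).** If `R` is generated over `A` by a root `x` of `f`, any
`A`-algebra map `g : R → A[X]/(f)` with `g x = X̄` is bijective: the canonical map
`i : A[X]/(f) → R`, `X̄ ↦ x`, is surjective (its range contains the generator) and `g ∘ i = id`
(both sides agree on `X̄`). -/
theorem adjoinRoot_squeeze_of_aeval {A R : Type*} [CommRing A] [CommRing R] [Algebra A R]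
    (f : A[X]) (x : R) (hfx : aeval x f = 0)
    (hgen : Algebra.adjoin A {x} = ⊤)
    (g : R →ₐ[A] AdjoinRoot f) (hg : g x = AdjoinRoot.root f) :
    Function.Bijective g := by
  -- a section `i : A[X]/(f) → R`, `root ↦ x`
  obtain ⟨i, hi_root⟩ : ∃ i : AdjoinRoot f →ₐ[A] R, i (AdjoinRoot.root f) = x :=
    ⟨AdjoinRoot.liftAlgHom f (Algebra.ofId A R) x hfx, AdjoinRoot.liftAlgHom_root _ _ _ _⟩
  -- `g ∘ i = id` since both fix `root f`
  have hgi : g.comp i = AlgHom.id A (AdjoinRoot f) := by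
    apply AdjoinRoot.algHom_ext
    simp [hi_root, hg]
  have hsec : ∀ s, g (i s) = s := fun s => by
    simpa using DFunLike.congr_fun hgi s
  -- `i` is surjective because its range contains the generator `x`
  have hi_surj : Function.Surjective i := by
    have htop : (⊤ : Subalgebra A R) ≤ i.range := by
      rw [← hgen]
      refine Algebra.adjoin_le ?_
      intro y hy
      rw [Set.mem_singleton_iff] at hy
      subst hy
      exact (AlgHom.mem_range i).mpr ⟨AdjoinRoot.root f, hi_root⟩
    intro r
    exact (AlgHom.mem_range i).mp (htop Algebra.mem_top)
  refine ⟨?_, ?_⟩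
  · intro r₁ r₂ h
    obtain ⟨s₁, rfl⟩ := hi_surj r₁
    obtain ⟨s₂, rfl⟩ := hi_surj r₂
    rw [hsec, hsec] at h
    rw [h]
  · intro t
    exact ⟨i t, hsec t⟩

/-- `x` is a root of `X * (X - C a)` when `x * (x - a) = 0`. -/
theorem aeval_X_mul_X_sub_C_eq_zero {A R : Type*} [CommRing A] [CommRing R] [Algebra A R]
    (a : A) (x : R) (hx : x * (x - algebraMap A R a) = 0) :
    aeval x (X * (X - C a) : A[X]) = 0 := by
  simp [hx]

/-- **AdjoinRoot squeeze (the cell-model case `f = X (X - a)`).** An `A`-algebra generated by one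
element `x` with `x * (x - a) = 0` that maps to `A[X]/(X (X - a))` with `x ↦ X̄` does so bijectively. -/
theorem adjoinRoot_squeeze {A R : Type*} [CommRing A] [CommRing R] [Algebra A R]
    (a : A) (x : R) (hx : x * (x - algebraMap A R a) = 0)
    (hgen : Algebra.adjoin A {x} = ⊤)
    (g : R →ₐ[A] AdjoinRoot (X * (X - C a) : A[X]))
    (hg : g x = AdjoinRoot.root (X * (X - C a) : A[X])) :
    Function.Bijective g :=
  adjoinRoot_squeeze_of_aeval (X * (X - C a) : A[X]) x (aeval_X_mul_X_sub_C_eq_zero a x hx) hgen g hg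

/-- Same, packaged as an `A`-algebra isomorphism whose underlying map is `g`. -/
theorem adjoinRoot_squeeze_equiv {A R : Type*} [CommRing A] [CommRing R] [Algebra A R]
    (a : A) (x : R) (hx : x * (x - algebraMap A R a) = 0)
    (hgen : Algebra.adjoin A {x} = ⊤)
    (g : R →ₐ[A] AdjoinRoot (X * (X - C a) : A[X]))
    (hg : g x = AdjoinRoot.root (X * (X - C a) : A[X])) :
    ∃ e : R ≃ₐ[A] AdjoinRoot (X * (X - C a) : A[X]), (e : R → AdjoinRoot (X * (X - C a) : A[X])) = g :=
  ⟨AlgEquiv.ofBijective g (adjoinRoot_squeeze a x hx hgen g hg), rfl⟩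

end Summit.Langlands.Langlands.Theorems
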